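import Literature.Geometry.Kaehler.ComplexTorusAnalyticClassesPullback
import Literature.Geometry.Kaehler.ComplexTorusKernelImageIsogeny
import HarnessLib

/-!
# Descent of analytic classes along surjective homomorphisms: `f^*γ ∈ Aᵖ(X) ⟺ γ ∈ Aᵖ(X')`;
# restriction to complex subtori and to the slices `X₁ × 0`, `0 × X₂`

Layer `Literature/Geometry/Kaehler`, namespace `Literature.Geometry.Kaehler.ComplexTorus`; lane
`lit-hodgefound`, seat p07 (generation 35, file 7), programme «consequences of `D•(X) ⊆ A•(X)` and the
functoriality of `A•(X)`». With `f^* Aᵖ(X') ⊆ Aᵖ(X)` for every homomorphism `f`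
(`ComplexTorusAnalyticClassesPullback.lean`) and `f^* : Aᵖ(X') ⥲ Aᵖ(X)` for isogenies
(`IsIsogeny.comp_realRep_mem_analyticClasses_iff`), Poincaré's complete reducibility gives the converse
for SURJECTIVE homomorphisms out of an abelian variety: a rational class `γ ∈ H^{2p}(X', ℚ)` is analytic
as soon as `f^*γ` is (Swinnerton-Dyer, Thm. 34: `f` restricts to an isogeny `Z → X'` on the complement
`Z = ((Ker f)⁰)^⊥`; restrict `f^*γ` to `Z`).

* §1 **Restriction to a complex subtorus** `ι_Z : Z ↪ X` (`comp_realRep_subtorusMatrix_mem_analyticClasses`: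
  `ι_Z^* Aᵖ(X) ⊆ Aᵖ(Z)`), and to the two slices of a product
  (`comp_realRep_inrMatrix_mem_analyticClasses`; `comp_fst_mem_analyticClasses_iff`,
  `comp_snd_mem_analyticClasses_iff`: a class pulled back from a factor is analytic on `X₁ × X₂` iff it is
  analytic on the factor).
* §2 **Descent** (`IsRiemannForm.comp_realRep_mem_analyticClasses_iff_of_surjective`,
  `IsAbelianVariety.…`): for a surjective homomorphism `f : X → X'` out of an abelian variety and a rational
  class `γ` of `X'`, `f^*γ ∈ Aᵖ(X) ⟺ γ ∈ Aᵖ(X')`.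

Theorems only; no definitions, no named facts.

## References

* [SwinnertonDyer1974AbelianVarieties] H. P. F. Swinnerton-Dyer, *Analytic Theory of Abelian Varieties*,
  CUP 1974, Ch. II §7 Thm. 34 (pp. 55–57).
* [Lange2023AbelianVarietiesComplex] H. Lange, *Abelian Varieties over the Complex Numbers*, Springer 2023,
  §1.1.2 Lemma 1.1.11, §2.4.4 Thm. 2.4.23 (Poincaré), §7.3.3 Exercise (1) (p. 341).
* [Fulton1998] W. Fulton, *Intersection Theory*, 2nd ed., Springer 1998, §19.2 Cor. 19.2 (b); Example 1.7.4
  (`f_* f^* = deg f`).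
-/

noncomputable section

open scoped Manifold Topology
open MeasureTheory Set Function Module WithLp

universe u

namespace Literature.Geometry.Kaehler

namespace ComplexTorus

/-! ### §1 Restriction to complex subtori and to the slices of a product -/

section Subtorus

variable {ι : Type*} [Fintype ι] [DecidableEq ι] {E : Type u} [NormedAddCommGroup E] [InnerProductSpace ℂ E]
  [FiniteDimensional ℂ E] [MeasurableSpace E] [BorelSpace E] (Φ : (ι → ℝ) ≃L[ℝ] E) {n : ℕ} (e : Fin n ≃ ι)
  {Z : Submodule ℝ (ι → ℝ)} (hZ : IsLatticeSubspace Z) (hZc : IsComplexSubspace Φ Z) {nZ : ℕ}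
  (eZ : Fin nZ ≃ Fin (subRank Z))

/-- **`ι_Z^* Aᵖ(X) ⊆ Aᵖ(Z)` for a complex subtorus `ι_Z : Z ↪ X`**: the embedding `ρ(C_Z)` is a
homomorphism with `ℂ`-linear analytic representation (the inclusion `Φ(Z ⊗ ℝ) ⊆ E`), so
`f^* Aᵖ ⊆ Aᵖ` applies. [cite: Fulton1998, §19.2 Cor. 19.2 (b)]
[cite: Lange2023AbelianVarietiesComplex, §1.1.2 (p. 19) and §7.3.3 Exercise (1) (p. 341)] -/
theorem comp_realRep_subtorusMatrix_mem_analyticClasses {p : ℕ} {γ : E [⋀^Fin (2 * p)]→L[ℝ] ℂ}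
    (hγ : γ ∈ analyticClasses Φ e p) :
    γ.compContinuousLinearMap (realRep (subtorusPeriod Φ Z hZ hZc) Φ (subtorusMatrix Z)) ∈
      analyticClasses (subtorusPeriod Φ Z hZ hZc) eZ p :=
  comp_realRep_mem_analyticClasses_of_exists_analyticRep (subtorusPeriod Φ Z hZ hZc) Φ eZ e
    ⟨(cxSpan Φ Z).subtypeL, fun y ↦ by rw [Submodule.subtypeL_apply, coe_subtorusPeriod]⟩ hγ

end Subtorus

section Slices

variable {ι₁ ι₂ : Type*} [Fintype ι₁] [Fintype ι₂] [DecidableEq ι₁] [DecidableEq ι₂]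
  {E₁ : Type u} [NormedAddCommGroup E₁] [InnerProductSpace ℂ E₁] [FiniteDimensional ℂ E₁]
  [MeasurableSpace E₁] [BorelSpace E₁]
  {E₂ : Type u} [NormedAddCommGroup E₂] [InnerProductSpace ℂ E₂] [FiniteDimensional ℂ E₂]
  [MeasurableSpace E₂] [BorelSpace E₂]
  (Φ₁ : (ι₁ → ℝ) ≃L[ℝ] E₁) (Φ₂ : (ι₂ → ℝ) ≃L[ℝ] E₂) {n₁ n₂ : ℕ} (e₁ : Fin n₁ ≃ ι₁) (e₂ : Fin n₂ ≃ ι₂)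
  {p : ℕ}

omit [DecidableEq ι₁] [FiniteDimensional ℂ E₁] [MeasurableSpace E₁] [BorelSpace E₁]
  [FiniteDimensional ℂ E₂] [MeasurableSpace E₂] [BorelSpace E₂] in
/-- **The analytic representation of `i₁ : X₂ → X₁ × X₂`, `y ↦ (0, y)`** (rational representation
`⟨0; 1⟩ = inrMatrix`) on the Euclidean product. [cite: Lange2023AbelianVarietiesComplex, §1.1.2] -/
theorem realRep_inrMatrix_prodPeriodL2_apply (y : E₂) :
    realRep Φ₂ (prodPeriodL2 Φ₁ Φ₂) (inrMatrix ι₁ ι₂) y = toLp 2 (0, y) := by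
  have hy : y = Φ₂ (Φ₂.symm y) := (ContinuousLinearEquiv.apply_symm_apply Φ₂ y).symm
  rw [hy, realRep_apply, inrMatrix, Matrix.fromRows_map, Matrix.fromRows_mulVec,
    Matrix.map_one Int.cast Int.cast_zero Int.cast_one, Matrix.map_zero Int.cast Int.cast_zero,
    Matrix.one_mulVec, Matrix.zero_mulVec, prodPeriodL2_apply, prodPeriod_apply, ← hy]
  simp only [Sum.elim_inl, Sum.elim_inr, map_zero]
  exact congrArg (fun z ↦ toLp 2 ((0 : E₁), z)) (Φ₂.apply_symm_apply y)

/-- **`i₁^* Aᵖ(X₁ × X₂) ⊆ Aᵖ(X₂)`** for the slice `i₁ : X₂ → X₁ × X₂`, `y ↦ (0, y)` (a homomorphism with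
`ℂ`-linear analytic representation). [cite: Fulton1998, §19.2 Cor. 19.2 (b)]
[cite: Lange2023AbelianVarietiesComplex, §7.3.3 Exercise (1) (p. 341)] -/
theorem comp_realRep_inrMatrix_mem_analyticClasses {β : WithLp 2 (E₁ × E₂) [⋀^Fin (2 * p)]→L[ℝ] ℂ}
    (hβ : β ∈ analyticClasses (prodPeriodL2 Φ₁ Φ₂) (sumEnum e₁ e₂) p) :
    β.compContinuousLinearMap (realRep Φ₂ (prodPeriodL2 Φ₁ Φ₂) (inrMatrix ι₁ ι₂)) ∈
      analyticClasses Φ₂ e₂ p := by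
  refine comp_realRep_mem_analyticClasses_of_exists_analyticRep Φ₂ (prodPeriodL2 Φ₁ Φ₂) e₂ (sumEnum e₁ e₂)
    ⟨((WithLp.prodContinuousLinearEquiv 2 ℂ E₁ E₂).symm : E₁ × E₂ →L[ℂ] WithLp 2 (E₁ × E₂)).comp
      (ContinuousLinearMap.inr ℂ E₁ E₂), fun x ↦ ?_⟩ hβ
  rw [← realRep_apply (Φ := Φ₂) (Φ' := prodPeriodL2 Φ₁ Φ₂), realRep_inrMatrix_prodPeriodL2_apply]
  rfl

/-- **`pr₁^*α ∈ Aᵖ(X₁ × X₂) ⟺ α ∈ Aᵖ(X₁)`**: a class pulled back from the first factor is analytic on the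
product iff it is analytic on the factor (`⟸`: `pr₁^*[Z] = [Z × X₂]`; `⟹`: restrict to `X₁ × 0`,
`i₀^* pr₁^* = id`). [cite: Fulton1998, §1.7 and §19.2 Cor. 19.2 (b)]
[cite: Lange2023AbelianVarietiesComplex, §6.2.4 proof of Prop. 6.2.20] -/
theorem comp_fst_mem_analyticClasses_iff {α : E₁ [⋀^Fin (2 * p)]→L[ℝ] ℂ} :
    α.compContinuousLinearMap ((ContinuousLinearMap.fst ℝ E₁ E₂).comp
      (WithLp.prodContinuousLinearEquiv 2 ℝ E₁ E₂ : WithLp 2 (E₁ × E₂) →L[ℝ] E₁ × E₂)) ∈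
      analyticClasses (prodPeriodL2 Φ₁ Φ₂) (sumEnum e₁ e₂) p ↔ α ∈ analyticClasses Φ₁ e₁ p := by
  refine ⟨fun h ↦ ?_, comp_fst_mem_analyticClasses Φ₁ Φ₂ e₁ e₂⟩
  have h1 := comp_realRep_inlMatrix_mem_analyticClasses Φ₁ Φ₂ e₁ e₂ h
  have heq : (α.compContinuousLinearMap ((ContinuousLinearMap.fst ℝ E₁ E₂).comp
      (WithLp.prodContinuousLinearEquiv 2 ℝ E₁ E₂ : WithLp 2 (E₁ × E₂) →L[ℝ] E₁ × E₂))).compContinuousLinearMap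
      (realRep Φ₁ (prodPeriodL2 Φ₁ Φ₂) (inlMatrix ι₁ ι₂)) = α := by
    ext v
    simp only [ContinuousAlternatingMap.compContinuousLinearMap_apply, Function.comp_def,
      realRep_inlMatrix_prodPeriodL2_apply]
    rfl
  rwa [heq] at h1

/-- **`pr₂^*α ∈ Aᵖ(X₁ × X₂) ⟺ α ∈ Aᵖ(X₂)`** (restrict to `0 × X₂`). [cite: Fulton1998, §1.7 and §19.2 Cor. 19.2 (b)]
[cite: Lange2023AbelianVarietiesComplex, §6.2.4 proof of Prop. 6.2.20] -/
theorem comp_snd_mem_analyticClasses_iff {α : E₂ [⋀^Fin (2 * p)]→L[ℝ] ℂ} :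
    α.compContinuousLinearMap ((ContinuousLinearMap.snd ℝ E₁ E₂).comp
      (WithLp.prodContinuousLinearEquiv 2 ℝ E₁ E₂ : WithLp 2 (E₁ × E₂) →L[ℝ] E₁ × E₂)) ∈
      analyticClasses (prodPeriodL2 Φ₁ Φ₂) (sumEnum e₁ e₂) p ↔ α ∈ analyticClasses Φ₂ e₂ p := by
  refine ⟨fun h ↦ ?_, comp_snd_mem_analyticClasses Φ₁ Φ₂ e₁ e₂⟩
  have h1 := comp_realRep_inrMatrix_mem_analyticClasses Φ₁ Φ₂ e₁ e₂ h
  have heq : (α.compContinuousLinearMap ((ContinuousLinearMap.snd ℝ E₁ E₂).comp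
      (WithLp.prodContinuousLinearEquiv 2 ℝ E₁ E₂ : WithLp 2 (E₁ × E₂) →L[ℝ] E₁ × E₂))).compContinuousLinearMap
      (realRep Φ₂ (prodPeriodL2 Φ₁ Φ₂) (inrMatrix ι₁ ι₂)) = α := by
    ext v
    simp only [ContinuousAlternatingMap.compContinuousLinearMap_apply, Function.comp_def,
      realRep_inrMatrix_prodPeriodL2_apply]
    rfl
  rwa [heq] at h1

end Slices

/-! ### §2 Descent along surjective homomorphisms -/

section Descent

variable {ι ι' : Type*} [Fintype ι] [Fintype ι'] [DecidableEq ι] [DecidableEq ι'] {E E' : Type u}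
  [NormedAddCommGroup E] [InnerProductSpace ℂ E] [FiniteDimensional ℂ E] [MeasurableSpace E] [BorelSpace E]
  [NormedAddCommGroup E'] [InnerProductSpace ℂ E'] [FiniteDimensional ℂ E'] [MeasurableSpace E']
  [BorelSpace E'] (Φ : (ι → ℝ) ≃L[ℝ] E) (Φ' : (ι' → ℝ) ≃L[ℝ] E') {n n' : ℕ} (e : Fin n ≃ ι) (e' : Fin n' ≃ ι')
  {η : E [⋀^Fin 2]→L[ℝ] ℝ} {A : Matrix ι' ι ℤ} {p : ℕ}

/-- Private re-association of pull-backs of forms. [folklore] -/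
private theorem compContinuousLinearMap_compContinuousLinearMap' {V W U : Type*} [NormedAddCommGroup V]
    [NormedSpace ℝ V] [NormedAddCommGroup W] [NormedSpace ℝ W] [NormedAddCommGroup U] [NormedSpace ℝ U]
    {k : ℕ} (γ : U [⋀^Fin k]→L[ℝ] ℂ) (g : W →L[ℝ] U) (f : V →L[ℝ] W) :
    (γ.compContinuousLinearMap g).compContinuousLinearMap f = γ.compContinuousLinearMap (g.comp f) := by
  ext v; rfl

/-- **Descent: `f^*γ ∈ Aᵖ(X) ⟺ γ ∈ Aᵖ(X')` for a SURJECTIVE homomorphism `f = ρ(A) : X → X'` out of a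
polarised abelian variety `(X, η)` and a rational class `γ ∈ H^{2p}(X', ℚ)`.** `⟸` holds for every
homomorphism; for `⟹`, by Poincaré's complete reducibility `f` restricts to an ISOGENY `f ∘ ι_Z : Z → X'` on
the complex subtorus `Z = ((Ker f)⁰)^⊥` (Swinnerton-Dyer, proof of Thm. 34;
`IsRiemannForm.isIsogeny_mul_subtorusMatrix_orthSubspace`), `ι_Z^*(f^*γ) = (f ∘ ι_Z)^*γ` is analytic on `Z`
(§1), and `g^*γ ∈ Aᵖ ⟺ γ ∈ Aᵖ` for the isogeny `g` (`IsIsogeny.comp_realRep_mem_analyticClasses_iff`).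
Classically: `γ = (1/deg) g_* g^*γ`. [cite: SwinnertonDyer1974AbelianVarieties, Ch. II §7 Thm. 34 (proof), pp. 55–57]
[cite: Lange2023AbelianVarietiesComplex, §2.4.4 Thm. 2.4.23 and §7.3.3 Exercise (1) (p. 341)]
[cite: Fulton1998, §1.7 Example 1.7.4 and §19.2 Cor. 19.2 (b)] -/
theorem IsRiemannForm.comp_realRep_mem_analyticClasses_iff_of_surjective (hη : IsRiemannForm Φ η)
    (hA : ∃ F : E →L[ℂ] E', ∀ x, Φ' ((A.map (Int.cast : ℤ → ℝ)).mulVec x) = F (Φ x))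
    (hs : Surjective (mapMatrix Φ Φ' A)) {γ : E' [⋀^Fin (2 * p)]→L[ℝ] ℂ} (hγ : γ ∈ rationalForms Φ' (2 * p)) :
    γ.compContinuousLinearMap (realRep Φ Φ' A) ∈ analyticClasses Φ e p ↔ γ ∈ analyticClasses Φ' e' p := by
  classical
  refine ⟨fun h ↦ ?_, comp_realRep_mem_analyticClasses_of_exists_analyticRep Φ Φ' e e' hA⟩
  obtain ⟨F, hF⟩ := hA
  -- the kernel subspace and its Poincaré complement `Z`
  have hKl : IsLatticeSubspace (LinearMap.ker ((A.map (Int.cast : ℤ → ℝ))).mulVecLin) :=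
    isLatticeSubspace_ker_mulVecLin A
  have hKc : IsComplexSubspace Φ (LinearMap.ker ((A.map (Int.cast : ℤ → ℝ))).mulVecLin) :=
    isComplexSubspace_ker_of_analyticRep Φ Φ' hF
  obtain ⟨hZ, hZc, -⟩ := poincare_reducibility Φ hη hKl hKc
  have hg := hη.isIsogeny_mul_subtorusMatrix_orthSubspace Φ Φ' hF hs rfl hKc hZ hZc
  -- `Z` has the rank of `X'`
  set Z := orthSubspace Φ η (LinearMap.ker ((A.map (Int.cast : ℤ → ℝ))).mulVecLin) with hZdef
  have hrk : n' = subRank Z := by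
    have h1 := finrank_complex_mul_two (subtorusPeriod Φ Z hZ hZc) (Equiv.refl (Fin (subRank Z)))
    have h2 := finrank_complex_mul_two Φ' e'
    have h3 := hg.finrank_eq (subtorusPeriod Φ Z hZ hZc) Φ'
    omega
  -- restrict `f^*γ` to `Z`: this is `(f ∘ ι_Z)^*γ`
  have h1 := comp_realRep_subtorusMatrix_mem_analyticClasses Φ e hZ hZc (finCongr hrk) h
  rw [compContinuousLinearMap_compContinuousLinearMap', realRep_mul] at h1
  exact (hg.comp_realRep_mem_analyticClasses_iff (subtorusPeriod Φ Z hZ hZc) Φ' (finCongr hrk) e' hγ).1 h1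

/-- **Descent for an abelian variety `X`** (some polarisation): `f^*γ ∈ Aᵖ(X) ⟺ γ ∈ Aᵖ(X')` for a
surjective homomorphism `f : X → X'` and a rational class `γ` of `X'`.
[cite: SwinnertonDyer1974AbelianVarieties, Ch. II §7 Thm. 34, pp. 55–57]
[cite: Lange2023AbelianVarietiesComplex, §7.3.3 Exercise (1) (p. 341)] -/
theorem IsAbelianVariety.comp_realRep_mem_analyticClasses_iff_of_surjective (hX : IsAbelianVariety Φ)
    (hA : ∃ F : E →L[ℂ] E', ∀ x, Φ' ((A.map (Int.cast : ℤ → ℝ)).mulVec x) = F (Φ x))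
    (hs : Surjective (mapMatrix Φ Φ' A)) {γ : E' [⋀^Fin (2 * p)]→L[ℝ] ℂ} (hγ : γ ∈ rationalForms Φ' (2 * p)) :
    γ.compContinuousLinearMap (realRep Φ Φ' A) ∈ analyticClasses Φ e p ↔ γ ∈ analyticClasses Φ' e' p := by
  obtain ⟨η, hη⟩ := hX
  exact hη.comp_realRep_mem_analyticClasses_iff_of_surjective Φ Φ' e e' hA hs hγ

/-- **The Hodge `(p,p)`-conjecture in cycle form descends along surjections**: if `f : X → X'` is a
surjective homomorphism out of an abelian variety with `Aᵖ(X) = H^{2p}_Hodge(X)`, then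
`Aᵖ(X') = H^{2p}_Hodge(X')` (`f^*` carries Hodge classes to Hodge classes).
[cite: Lange2023AbelianVarietiesComplex, §7.3.3 Exercise (1)(b) (p. 341)]
[cite: SwinnertonDyer1974AbelianVarieties, Ch. II §7 Thm. 34, pp. 55–57] -/
theorem IsAbelianVariety.analyticClasses_eq_hodgeClasses_of_surjective (hX : IsAbelianVariety Φ)
    (hA : ∃ F : E →L[ℂ] E', ∀ x, Φ' ((A.map (Int.cast : ℤ → ℝ)).mulVec x) = F (Φ x))
    (hs : Surjective (mapMatrix Φ Φ' A)) (h : analyticClasses Φ e p = hodgeClasses Φ p) :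
    analyticClasses Φ' e' p = hodgeClasses Φ' p := by
  refine le_antisymm (analyticClasses_le_hodgeClasses Φ' e' p) fun γ hγ ↦ ?_
  obtain ⟨F, hF⟩ := hA
  have hγr : γ ∈ rationalForms Φ' (2 * p) := hodgeClasses_le_rationalForms Φ' p hγ
  have h1 : γ.compContinuousLinearMap (realRep Φ Φ' A) ∈ hodgeClasses Φ p :=
    comp_realRep_mem_hodgeClassesIn Φ Φ' A (fun c u ↦ by
      rw [← analyticRep_restrictScalars hF, ContinuousLinearMap.coe_restrictScalars', map_smul]) hγ
  rw [← h] at h1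
  exact (hX.comp_realRep_mem_analyticClasses_iff_of_surjective Φ Φ' e e' ⟨F, hF⟩ hs hγr).1 h1

end Descent

end ComplexTorus

end Literature.Geometry.Kaehler
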